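import Summits.QuantumFields.BalabanUV.Beta.EriceRemainderEnclosureHistoryAutonomyComparisonWindowSeven
import Summits.QuantumFields.BalabanUV.Beta.EriceRemainderEnclosureHistoryAutonomyComparisonZonesUniform

/-!
# EriceRemainderEnclosureHistoryAutonomyComparisonWindowBlocks — (E63f) THE PROFILE SUM OF A WINDOW WITH MARGIN, AND TWO DENSE BLOCKS FAR APART COMPARE AT
# ANY SIZE: for `L ≥ 0` with every age `k ≥ 1` in `[K₀, W·K₀]`, `Σ_j L_j∕P_j ≤ log(ρ∕σ)∕(ρ − σ)` for every `0 < σ < ρ = 1∕√2` with `σ²(W+1) ≤ 1` ((E63e)'s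
# Riemann-sum bound with the margin kept); `W = 3`, `σ = ½`: `≤ log 2∕(√2 − 1) < 2·0.84` — (E58c)'s factor-3 window passes (E58b)'s profile condition WITH
# MARGIN `q = 0.84`; hence by (E63b)'s uniform zones theorem TWO DENSE BLOCKS `[K₀, 3K₀]`, `[K₁, 3K₁]` with `K₁ ≥ 390·K₀` (ANY number of ages, ALL sizes and the
# Markov weight ARBITRARY) compare at any size — the first class with two dense blocks

Cell `pub-balaban`, β-function sub-cell, BINDER row D4 «RemainderConst leaves for Bałaban's split» (`HOME/BINDER-OWNERS.md`; owner lineage `b2b-balaban-beta-an4`;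
this file by co-owner #2 lineage `b2b-balaban-beta-d4-p2`, generation 56), β-FLOW TEAM duty (1), FREEZE (0) honoured (def-free; (E63e)'s `sum_div_cumul_le_log`,
(E63b)'s `le_of_isotone_excess_zones_uniform`, Mathlib's `Real.log_two_lt_d9` ∕ `Real.add_pow_le_pow_mul_pow_of_sq_le_sq` BY NAME; nothing restated).  Sixth file of
gen 56's station (E63).

HONEST FRAMING (page 1, verbatim and binding).  *"Discharging BetaPertH makes Bałaban's UV stability UNCONDITIONAL — a real constructive-QFT result; it is
NOT the continuum limit and NOT the Clay problem."*  THIS FILE DISCHARGES NOTHING OF THE KIND.  Elementary real analysis about ABSTRACT affine functionals on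
a box ]0,γ]^ℕ — hypotheses of a census, not facts; the age profile of Bałaban's (1.22) limit functional is NOT PRINTED ([I] p. 298; GAPS G-t4-U2-1∕-2) and NOT
asserted.  Row D4 class UNCHANGED (critical-path width 0; instance 0∕1; D4 DISCHARGE NO DATE).  HONEST DEPENDENCY: continuum YM on T⁴ ⇐ BetaPertH ∧ nine
spine estimates (0/9 proved); BetaPertH ⇐ (D1) ∧ (D4) ∧ CAP+tail; G-an2-4 gates asym, D1 and NE2/3/4.

THE POINT (census sense (α); the COMPARISON column, conjecture (E58′)).  (E63b)'s zones theorem needs every zone to pass the profile condition WITH A MARGIN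
`q < 1`; the window bounds of the column were proved without one ((E58c): `P_j ≥ T∕2`, sum `≤ 2`; (E61c): `≤ 2·0.98`).  (E63e)'s Riemann-sum bound keeps the
margin: ages in `[K₀, W K₀]` read younger ages with `≥ ρ` and older ones with `≥ σ`, `σ²(W+1) ≤ 1`, so `P_j ≥ σT + (ρ−σ)S_{j+1}` (§1 `read_ge_of_window`) and
`Σ_j L_j∕P_j ≤ (1∕(ρ−σ))·log((σ + (ρ−σ))∕σ) = log(ρ∕σ)∕(ρ−σ)` (§1 `profileSum_le_log_of_window`): `W = 1`: `√2` (one age); `W = 3`, `σ = ½`: `log 2∕(√2−1) ≈ 1.673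
≤ 2·0.84` (§1 `profileSum_le_of_window_three`); `W = 7`: (E63e).  §2: two blocks `[K₀,3K₀]`, `[K₁,3K₁]`, zone map «`k ≤ 3K₀`», margin `q = 0.84`, `N ≤ 2`,
separation `t = 1∕130` (`(3·0.84 + 4)∕130 ≤ 2·0.16²`), i.e. `K₁ ≥ 390·K₀`: **`le_of_isotone_excess_two_blocks_far`** — the zone sums are bounded through the
profile RESTRICTED to the block (the other block and the Markov weight only enlarge every `P_j`).  NOT CLAIMED: blocks wider than a factor `3` at this
separation (factor `7` has margin `0.02` only); two blocks closer than `390`; anything printed.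

WHAT IS PROVED ([folklore]; 0 `def`, 0 sorry).  §1 **`read_ge_of_window`**, **`profileSum_le_log_of_window`**, **`profileSum_le_of_window_three`**,
`profileSum_restrict_le`.  §2 **`le_of_isotone_excess_two_blocks_far`**.
-/
noncomputable section
open Finset Set

namespace Summit.QuantumFields.BalabanUV.Beta.EriceRemainderEnclosureHistoryAutonomyComparisonWindowBlocks

open Literature.MathematicalPhysics.QuantumFieldTheory.Balaban1983to89
open Literature.MathematicalPhysics.QuantumFieldTheory.Balaban1983to89.T4BetaStationary
open Literature.MathematicalPhysics.QuantumFieldTheory.Balaban1983to89.T4BetaFlowWellPosed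
open Summit.QuantumFields.BalabanUV.Beta.EriceRemainderEnclosureHistoryAutonomyComparisonWindowSeven (sum_div_cumul_le_log)
open Summit.QuantumFields.BalabanUV.Beta.EriceRemainderEnclosureHistoryAutonomyComparisonZonesUniform (le_of_isotone_excess_zones_uniform)

variable {B' : (ℕ → ℝ) → ℝ} {M' γ b : ℝ} {L : ℕ → ℝ} {K : ℕ} {h h' : ℕ → ℝ}

/-! ## §1 The profile sum of a window, with the margin kept -/

/-- **THE READS ON A WINDOW `[K₀, W·K₀]`**: `L ≥ 0` with every age `k ≥ 1` carrying weight in `[K₀, W K₀]`; `0 ≤ σ` with `σ²·(W+1) ≤ 1`.  An age `j ≥ K₀` of the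
window reads every `k ≤ j` with weight `≥ √(1∕2)` and every weighted `k` with `≥ σ`: `σ·T + (√(1∕2) − σ)·S_{j+1} ≤ P_j`, `T = Σ_k L_k`, `S_{j+1} = Σ_{i≤j} L_i`.
[folklore] -/
theorem read_ge_of_window {K₀ W j : ℕ} {σ : ℝ} (hL : ∀ k, 0 ≤ L k) (hK₀ : 1 ≤ K₀) (hwin : ∀ k, k ≠ 0 → L k ≠ 0 → K₀ ≤ k ∧ k ≤ W * K₀)
    (hσ0 : 0 ≤ σ) (hσW : σ ^ 2 * ((W : ℝ) + 1) ≤ 1) (hjK : j < K) (hj : K₀ ≤ j) :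
    σ * ∑ k ∈ range K, L k + (Real.sqrt (1 / 2) - σ) * ∑ i ∈ range (j + 1), L i ≤ ∑ k ∈ range K, L k * Real.sqrt ((j : ℝ) / ((j : ℝ) + k)) := by
  have hK₀r : (1 : ℝ) ≤ K₀ := by exact_mod_cast hK₀
  have hjr : (K₀ : ℝ) ≤ j := by exact_mod_cast hj
  have hW0 : (0 : ℝ) ≤ W := Nat.cast_nonneg W
  set ρ : ℝ := Real.sqrt (1 / 2) with hρ_def
  have hsplit : ∑ i ∈ range (j + 1), L i = ∑ k ∈ (range K).filter (fun k => k ≤ j), L k := by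
    refine sum_congr ?_ fun _ _ => rfl
    ext k; simp only [Finset.mem_range, Finset.mem_filter]; omega
  have hT : ∑ k ∈ range K, L k = ∑ k ∈ (range K).filter (fun k => k ≤ j), L k + ∑ k ∈ (range K).filter (fun k => ¬k ≤ j), L k :=
    (sum_filter_add_sum_filter_not (range K) (fun k => k ≤ j) L).symm
  rw [hsplit, hT, ← sum_filter_add_sum_filter_not (range K) (fun k => k ≤ j) (fun k => L k * Real.sqrt ((j : ℝ) / ((j : ℝ) + k)))]
  have hyoung : ∀ k ∈ (range K).filter (fun k => k ≤ j), ρ * L k ≤ L k * Real.sqrt ((j : ℝ) / ((j : ℝ) + k)) := by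
    intro k hk
    obtain ⟨-, hkj⟩ := mem_filter.mp hk
    have hkr : (k : ℝ) ≤ j := by exact_mod_cast hkj
    have hk0 : (0 : ℝ) ≤ k := Nat.cast_nonneg k
    have : (1 : ℝ) / 2 ≤ (j : ℝ) / ((j : ℝ) + k) := by rw [div_le_div_iff₀ (by norm_num) (by linarith)]; linarith
    rw [mul_comm]; exact mul_le_mul_of_nonneg_left (Real.sqrt_le_sqrt this) (hL k)
  have hold : ∀ k ∈ (range K).filter (fun k => ¬k ≤ j), σ * L k ≤ L k * Real.sqrt ((j : ℝ) / ((j : ℝ) + k)) := by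
    intro k hk
    obtain ⟨-, hkj⟩ := mem_filter.mp hk
    rcases (hL k).eq_or_lt with hLk | hLk
    · rw [← hLk]; simp
    have hkW := (hwin k (by omega) hLk.ne').2
    have hkr : (k : ℝ) ≤ W * K₀ := by exact_mod_cast hkW
    have hk0 : (0 : ℝ) ≤ k := Nat.cast_nonneg k
    have hfrac : σ ^ 2 ≤ (j : ℝ) / ((j : ℝ) + k) := by
      rw [le_div_iff₀ (by linarith)]
      have : σ ^ 2 * ((j : ℝ) + k) ≤ σ ^ 2 * ((j : ℝ) + W * j) := mul_le_mul_of_nonneg_left (by nlinarith) (sq_nonneg σ)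
      have e : σ ^ 2 * ((j : ℝ) + W * j) = σ ^ 2 * ((W : ℝ) + 1) * j := by ring
      nlinarith
    have : σ ≤ Real.sqrt ((j : ℝ) / ((j : ℝ) + k)) := by
      rw [show σ = Real.sqrt (σ ^ 2) by rw [Real.sqrt_sq hσ0]]; exact Real.sqrt_le_sqrt hfrac
    rw [mul_comm]; exact mul_le_mul_of_nonneg_left this (hL k)
  have h1 := sum_le_sum hyoung
  have h2 := sum_le_sum hold
  rw [← mul_sum] at h1 h2
  have hy0 : 0 ≤ ∑ k ∈ (range K).filter (fun k => k ≤ j), L k := sum_nonneg fun k _ => hL k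
  have ho0 : 0 ≤ ∑ k ∈ (range K).filter (fun k => ¬k ≤ j), L k := sum_nonneg fun k _ => hL k
  nlinarith

/-- **THE PROFILE SUM OF A WINDOW, MARGIN KEPT**: `L ≥ 0` with every age `k ≥ 1` carrying weight in `[K₀, W K₀]` (`K₀ ≥ 1`; Markov weight and number of ages
ARBITRARY), `0 < σ < ρ = √(1∕2)` with `σ²(W+1) ≤ 1`: `Σ_{j<K} L_j∕P_j ≤ (log ρ − log σ)∕(ρ − σ)` — a right-endpoint Riemann sum of the decreasing
`1∕(σ + (ρ−σ)s)` against the integral ((E63e) `sum_div_cumul_le_log`). [folklore] -/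
theorem profileSum_le_log_of_window {K₀ W : ℕ} {σ : ℝ} (hL : ∀ k, 0 ≤ L k) (hK₀ : 1 ≤ K₀) (hwin : ∀ k, k ≠ 0 → L k ≠ 0 → K₀ ≤ k ∧ k ≤ W * K₀)
    (hσ0 : 0 < σ) (hσW : σ ^ 2 * ((W : ℝ) + 1) ≤ 1) (hσρ : σ < Real.sqrt (1 / 2)) :
    ∑ j ∈ range K, L j / ∑ k ∈ range K, L k * Real.sqrt ((j : ℝ) / ((j : ℝ) + k))
      ≤ (Real.log (Real.sqrt (1 / 2)) - Real.log σ) / (Real.sqrt (1 / 2) - σ) := by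
  set ρ : ℝ := Real.sqrt (1 / 2) with hρ_def
  set d : ℝ := ρ - σ with hd_def
  have hd : 0 < d := by rw [hd_def]; linarith
  set T : ℝ := ∑ k ∈ range K, L k with hT_def
  have hT0 : 0 ≤ T := sum_nonneg fun k _ => hL k
  have hlogρσ : 0 ≤ Real.log ρ - Real.log σ := by
    rw [← Real.log_div (by positivity) hσ0.ne']; exact Real.log_nonneg (by rw [le_div_iff₀ hσ0]; linarith)
  rcases hT0.eq_or_lt with hT | hTpos
  · have hL0 : ∀ k ∈ range K, L k = 0 := fun k hk => (sum_eq_zero_iff_of_nonneg (fun k _ => hL k)).mp hT.symm k hk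
    rw [sum_eq_zero fun j hj => by rw [hL0 j hj, zero_div]]
    exact div_nonneg hlogρσ hd.le
  -- termwise: L_j/P_j ≤ L_j/(σT + d·S_{j+1}) = (1/d)·(dL_j)/(σT + Σ_{i≤j} dL_i)
  have hterm : ∀ j ∈ range K, L j / ∑ k ∈ range K, L k * Real.sqrt ((j : ℝ) / ((j : ℝ) + k))
      ≤ 1 / d * (d * L j / (σ * T + ∑ i ∈ range (j + 1), d * L i)) := by
    intro j hj
    have hS0 : 0 ≤ ∑ i ∈ range (j + 1), L i := sum_nonneg fun i _ => hL i
    rcases (hL j).eq_or_lt with hLj | hLj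
    · rw [← hLj]; simp
    rcases Nat.eq_zero_or_pos j with rfl | hjpos
    · have hP0 : ∑ k ∈ range K, L k * Real.sqrt (((0 : ℕ) : ℝ) / (((0 : ℕ) : ℝ) + k)) = 0 := sum_eq_zero fun k _ => by simp
      rw [hP0, div_zero]
      exact mul_nonneg (by positivity) (div_nonneg (by positivity) (by rw [← mul_sum]; positivity))
    have hwj := hwin j hjpos.ne' hLj.ne'
    have hP := read_ge_of_window hL hK₀ hwin hσ0.le hσW (mem_range.mp hj) hwj.1
    have hden : 0 < σ * T + d * ∑ i ∈ range (j + 1), L i := by positivity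
    calc L j / ∑ k ∈ range K, L k * Real.sqrt ((j : ℝ) / ((j : ℝ) + k)) ≤ L j / (σ * T + d * ∑ i ∈ range (j + 1), L i) :=
          div_le_div_of_nonneg_left (hL j) hden (by rw [hd_def]; exact hP)
      _ = 1 / d * (d * L j / (σ * T + ∑ i ∈ range (j + 1), d * L i)) := by rw [← mul_sum]; field_simp
  have hsum := sum_div_cumul_le_log (L := fun i => d * L i) (fun i => by have := hL i; positivity) (c := σ * T) (by positivity) K
  have hdT : ∑ i ∈ range K, d * L i = d * T := by rw [hT_def, mul_sum]
  rw [hdT] at hsum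
  have hlog : Real.log (σ * T + d * T) - Real.log (σ * T) = Real.log ρ - Real.log σ := by
    rw [← Real.log_div (by positivity) (by positivity), ← Real.log_div (by positivity) hσ0.ne']
    congr 1; rw [hd_def]; field_simp; ring
  calc ∑ j ∈ range K, L j / ∑ k ∈ range K, L k * Real.sqrt ((j : ℝ) / ((j : ℝ) + k))
      ≤ ∑ j ∈ range K, 1 / d * (d * L j / (σ * T + ∑ i ∈ range (j + 1), d * L i)) := sum_le_sum hterm
    _ = 1 / d * ∑ j ∈ range K, d * L j / (σ * T + ∑ i ∈ range (j + 1), d * L i) := (mul_sum _ _ _).symm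
    _ ≤ 1 / d * (Real.log ρ - Real.log σ) := mul_le_mul_of_nonneg_left (hsum.trans hlog.le) (by positivity)
    _ = (Real.log ρ - Real.log σ) / (ρ - σ) := by rw [hd_def]; field_simp

/-- **A FACTOR-3 WINDOW PASSES THE PROFILE CONDITION WITH MARGIN `q = 0.84`**: every age `k ≥ 1` in `[K₀, 3K₀]` (`K₀ ≥ 1`; Markov weight and number of
ages ARBITRARY) ⟹ `Σ_j L_j∕P_j ≤ log 2∕(√2 − 1) ≤ 2·0.84` (`σ = ½`). [folklore] -/
theorem profileSum_le_of_window_three {K₀ : ℕ} (hL : ∀ k, 0 ≤ L k) (hK₀ : 1 ≤ K₀) (hwin : ∀ k, k ≠ 0 → L k ≠ 0 → K₀ ≤ k ∧ k ≤ 3 * K₀) :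
    ∑ j ∈ range K, L j / ∑ k ∈ range K, L k * Real.sqrt ((j : ℝ) / ((j : ℝ) + k)) ≤ 2 * 0.84 := by
  have hρlo : (0.7071 : ℝ) ≤ Real.sqrt (1 / 2) := by
    rw [show (0.7071 : ℝ) = Real.sqrt (0.7071 ^ 2) by rw [Real.sqrt_sq (by norm_num)]]
    exact Real.sqrt_le_sqrt (by norm_num)
  have hρhi : Real.sqrt (1 / 2) < 0.7072 := by
    rw [show (0.7072 : ℝ) = Real.sqrt (0.7072 ^ 2) by rw [Real.sqrt_sq (by norm_num)]]
    exact Real.sqrt_lt_sqrt (by norm_num) (by norm_num)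
  have h := profileSum_le_log_of_window (K := K) (W := 3) (σ := 1 / 2) hL hK₀ hwin (by norm_num) (by norm_num) (by linarith)
  refine h.trans ?_
  -- log ρ − log ½ = log (2ρ) = log √2 = (log 2)/2 ≤ 0.3466; ρ − ½ ≥ 0.2071
  have hlog : Real.log (Real.sqrt (1 / 2)) - Real.log (1 / 2) = Real.log 2 / 2 := by
    rw [← Real.log_div (by positivity) (by norm_num), show Real.sqrt (1 / 2) / (1 / 2) = Real.sqrt 2 by
      rw [Real.sqrt_div' _ (by norm_num : (0:ℝ) ≤ 2), Real.sqrt_one]; field_simp; rw [Real.sq_sqrt (by norm_num)]]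
    rw [Real.log_sqrt (by norm_num)]
  rw [hlog, div_le_iff₀ (by linarith)]
  have := Real.log_two_lt_d9
  nlinarith

/-- RESTRICTION: the summands of the profile sum over a subset where `L` agrees with a smaller profile `L̃ ≤ L` are bounded by `L̃`'s full profile sum
(the discarded weights only enlarge every `P_j`). [folklore] -/
theorem profileSum_restrict_le {Lt : ℕ → ℝ} {s : Finset ℕ} (hLt : ∀ k, 0 ≤ Lt k) (hle : ∀ k, Lt k ≤ L k)
    (hs : s ⊆ range K) (heq : ∀ j ∈ s, Lt j = L j) :
    ∑ j ∈ s, L j / ∑ k ∈ range K, L k * Real.sqrt ((j : ℝ) / ((j : ℝ) + k))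
      ≤ ∑ j ∈ range K, Lt j / ∑ k ∈ range K, Lt k * Real.sqrt ((j : ℝ) / ((j : ℝ) + k)) := by
  have hPle : ∀ j, ∑ k ∈ range K, Lt k * Real.sqrt ((j : ℝ) / ((j : ℝ) + k)) ≤ ∑ k ∈ range K, L k * Real.sqrt ((j : ℝ) / ((j : ℝ) + k)) :=
    fun j => sum_le_sum fun k _ => mul_le_mul_of_nonneg_right (hle k) (Real.sqrt_nonneg _)
  have hPt0 : ∀ j, 0 ≤ ∑ k ∈ range K, Lt k * Real.sqrt ((j : ℝ) / ((j : ℝ) + k)) :=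
    fun j => sum_nonneg fun k _ => mul_nonneg (hLt k) (Real.sqrt_nonneg _)
  calc ∑ j ∈ s, L j / ∑ k ∈ range K, L k * Real.sqrt ((j : ℝ) / ((j : ℝ) + k))
      ≤ ∑ j ∈ s, Lt j / ∑ k ∈ range K, Lt k * Real.sqrt ((j : ℝ) / ((j : ℝ) + k)) := sum_le_sum fun j hj => by
        rw [← heq j hj]
        rcases (hLt j).eq_or_lt with hz | hzpos
        · rw [← hz]; simp
        rcases Nat.eq_zero_or_pos j with rfl | hjpos
        · -- age 0: both reads vanish, both summands read 0
          have e1 : ∑ k ∈ range K, L k * Real.sqrt (((0 : ℕ) : ℝ) / (((0 : ℕ) : ℝ) + k)) = 0 := sum_eq_zero fun k _ => by simp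
          have e2 : ∑ k ∈ range K, Lt k * Real.sqrt (((0 : ℕ) : ℝ) / (((0 : ℕ) : ℝ) + k)) = 0 := sum_eq_zero fun k _ => by simp
          rw [e1, e2]
        · have hjK : j ∈ range K := hs hj
          have hjr : (0 : ℝ) < j := by exact_mod_cast hjpos
          have hown : Lt j * Real.sqrt ((j : ℝ) / ((j : ℝ) + j)) ≤ ∑ k ∈ range K, Lt k * Real.sqrt ((j : ℝ) / ((j : ℝ) + k)) :=
            single_le_sum (f := fun k => Lt k * Real.sqrt ((j : ℝ) / ((j : ℝ) + k))) (fun k _ => mul_nonneg (hLt k) (Real.sqrt_nonneg _)) hjK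
          have hsq : 0 < Real.sqrt ((j : ℝ) / ((j : ℝ) + j)) := Real.sqrt_pos.mpr (by positivity)
          have hpos : 0 < ∑ k ∈ range K, Lt k * Real.sqrt ((j : ℝ) / ((j : ℝ) + k)) := lt_of_lt_of_le (mul_pos hzpos hsq) hown
          exact div_le_div_of_nonneg_left (hLt j) hpos (hPle j)
    _ ≤ ∑ j ∈ range K, Lt j / ∑ k ∈ range K, Lt k * Real.sqrt ((j : ℝ) / ((j : ℝ) + k)) :=
        sum_le_sum_of_subset_of_nonneg hs fun j _ _ => div_nonneg (hLt j) (hPt0 j)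

/-! ## §2 Two dense blocks far apart -/

/-- **TWO DENSE BLOCKS FAR APART COMPARE AT ANY SIZE.**  `B = b + Σ_{k<K} L_k·u_k` on ]0,γ] with `b > 0`, `L ≥ 0`, every age `k ≥ 1` carrying weight in
`[K₀, 3K₀] ∪ [K₁, 3K₁]` with `K₀ ≥ 1` and `K₁ ≥ 390·K₀` — the NUMBER of ages in each block, ALL sizes and the Markov weight `L_0` ARBITRARY; `B′` with zeroth
moment `M′ ≥ 0`, `B ≤ B′` on the box, the EXCESS `B′ − B` ISOTONE; `h`, `h′` ANY box solutions of `B`, `B′` from one pin `p ∈ ]0,γ]`.  Then `h′ ≤ h` at EVERY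
scale: (E63b)'s uniform zones theorem with the zone map «`k ≤ 3K₀`», margin `q = 0.84` from §1 (each zone sum bounded through the profile restricted to
its block), `N ≤ 2` zones and `t = 1∕130` (`(3·0.84·(N−1) + 4)∕130 ≤ 2·0.16^N`). [folklore] -/
theorem le_of_isotone_excess_two_blocks_far {p : ℝ} {K₀ K₁ : ℕ} (hL : ∀ k, 0 ≤ L k) (hb : 0 < b) (hK₀ : 1 ≤ K₀) (hK₁ : 390 * K₀ ≤ K₁)
    (hwin : ∀ k, k ≠ 0 → L k ≠ 0 → (K₀ ≤ k ∧ k ≤ 3 * K₀) ∨ (K₁ ≤ k ∧ k ≤ 3 * K₁))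
    (hB' : ∀ u u' : ℕ → ℝ, SeqBox γ u → SeqBox γ u' → ∀ D : ℝ, (∀ j, |u j - u' j| ≤ D) → |B' u - B' u'| ≤ M' * D) (hM' : 0 ≤ M')
    (hexc : ∀ u, SeqBox γ u → (fun u : ℕ → ℝ => b + ∑ k ∈ range K, L k * u k) u ≤ B' u)
    (hDmono : ∀ u v : ℕ → ℝ, SeqBox γ u → SeqBox γ v → (∀ j, u j ≤ v j) →
      B' u - (fun u : ℕ → ℝ => b + ∑ k ∈ range K, L k * u k) u ≤ B' v - (fun u : ℕ → ℝ => b + ∑ k ∈ range K, L k * u k) v)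
    (hp : 0 < p) (hpγ : p ≤ γ) (hh : SeqBox γ h) (hf : MemFlow (fun u : ℕ → ℝ => b + ∑ k ∈ range K, L k * u k) p h)
    (hh' : SeqBox γ h') (hf' : MemFlow B' p h') (j : ℕ) : h' j ≤ h j := by
  classical
  set A : Finset ℕ := (range K).filter (fun k => k ≠ 0 ∧ L k ≠ 0) with hA_def
  set z : ℕ → ℕ := fun k => if k ≤ 3 * K₀ then 0 else 1 with hz_def
  have hAK : A ⊆ range K := filter_subset _ _
  have hmemA : ∀ {k}, k ∈ A → k ≠ 0 ∧ L k ≠ 0 := fun hk => (mem_filter.mp hk).2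
  -- the blocks of the weighted ages, read off the zone map
  have hblock0 : ∀ k, k ≠ 0 → L k ≠ 0 → k ≤ 3 * K₀ → K₀ ≤ k ∧ k ≤ 3 * K₀ := by
    intro k hk0 hLk hle
    rcases hwin k hk0 hLk with h0 | h1
    · exact h0
    · omega
  have hblock1 : ∀ k, k ≠ 0 → L k ≠ 0 → ¬k ≤ 3 * K₀ → K₁ ≤ k ∧ k ≤ 3 * K₁ := by
    intro k hk0 hLk hgt
    rcases hwin k hk0 hLk with h0 | h1
    · omega
    · exact h1
  refine le_of_isotone_excess_zones_uniform (A := A) (z := z) (t := 1 / 130) (q := 0.84) hL hb hAK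
    (fun k hk => Nat.pos_of_ne_zero (hmemA hk).1) ?_ (by norm_num) ?_ (by norm_num) (by norm_num) ?_ ?_
    hB' hM' hexc hDmono hp hpγ hh hf hh' hf' j
  · -- outside A every age ≥ 1 carries no weight
    intro k hk hkA hk0
    by_contra hLk
    exact hkA (mem_filter.mpr ⟨hk, hk0, hLk⟩)
  · -- separation: a lower-zone age k ≤ 3K₀ and a higher-zone age k′ ≥ K₁ ≥ 390K₀
    intro k hk k' hk' hlt
    have hzk : k ≤ 3 * K₀ := by
      by_contra hc
      have : z k = 1 := by simp only [hz_def, hc, if_false]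
      have hz' : z k' ≤ 1 := by simp only [hz_def]; split_ifs <;> omega
      omega
    have hzk' : ¬k' ≤ 3 * K₀ := by
      intro hc
      have : z k' = 0 := by simp only [hz_def, hc, if_true]
      omega
    have hk'1 := (hblock1 k' (hmemA hk').1 (hmemA hk').2 hzk').1
    have h1 : (130 : ℝ) * k ≤ k' := by exact_mod_cast (show 130 * k ≤ k' by omega)
    rw [one_div_mul_eq_div, le_div_iff₀ (by norm_num : (0:ℝ) < 130)]
    linarith
  · -- every zone passes the profile condition with margin 0.84: restrict the profile to the block
    intro ζ hζ
    set Lt : ℕ → ℝ := fun k => if k ∈ A ∧ z k = ζ then L k else 0 with hLt_def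
    have hLt0 : ∀ k, 0 ≤ Lt k := fun k => by simp only [hLt_def]; split_ifs <;> [exact hL k; exact le_rfl]
    have hLtle : ∀ k, Lt k ≤ L k := fun k => by simp only [hLt_def]; split_ifs <;> [exact le_rfl; exact hL k]
    have heq : ∀ j ∈ A.filter (fun j => z j = ζ), Lt j = L j := fun j hj => by
      obtain ⟨hjA, hzj⟩ := mem_filter.mp hj
      simp only [hLt_def, hjA, hzj, and_self, if_true]
    have hres := profileSum_restrict_le (K := K) hLt0 hLtle ((filter_subset _ _).trans hAK) heq
    refine hres.trans ?_
    -- the restricted profile lives in ONE factor-3 window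
    have hsupport : ∀ k, k ≠ 0 → Lt k ≠ 0 → k ∈ A ∧ z k = ζ := fun k _ hk => by
      by_contra hc; exact hk (by simp only [hLt_def, hc, if_false])
    by_cases hζ0 : ζ = 0
    · refine profileSum_le_of_window_three (K₀ := K₀) hLt0 hK₀ fun k hk0 hLk => ?_
      obtain ⟨hkA, hzk⟩ := hsupport k hk0 hLk
      have hle : k ≤ 3 * K₀ := by
        by_contra hc; have : z k = 1 := by simp only [hz_def, hc, if_false]
        omega
      exact hblock0 k hk0 (hmemA hkA).2 hle
    · have hK₁1 : 1 ≤ K₁ := by omega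
      refine profileSum_le_of_window_three (K₀ := K₁) hLt0 hK₁1 fun k hk0 hLk => ?_
      obtain ⟨hkA, hzk⟩ := hsupport k hk0 hLk
      have hgt : ¬k ≤ 3 * K₀ := by
        intro hc; have : z k = 0 := by simp only [hz_def, hc, if_true]
        omega
      exact hblock1 k hk0 (hmemA hkA).2 hgt
  · -- at most two zones: (3·0.84·(N−1) + 4)/130 ≤ 2·0.16^N for N ≤ 2
    have hsub : A.image z ⊆ ({0, 1} : Finset ℕ) := by
      intro x hx
      obtain ⟨k, -, rfl⟩ := mem_image.mp hx
      simp only [hz_def, Finset.mem_insert, Finset.mem_singleton]; split_ifs <;> simp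
    have hcard : (A.image z).card ≤ 2 := (Finset.card_le_card hsub).trans (by simp)
    interval_cases (A.image z).card <;> norm_num

end Summit.QuantumFields.BalabanUV.Beta.EriceRemainderEnclosureHistoryAutonomyComparisonWindowBlocks

end
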